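import Mathlib
import HarnessLib

/-!
# Route `ColdStartUniversality` (fixed-cut-off SZZ dynamics; conjugation calculus, file 2):
# THE COORDINATE GENERATOR OF A QUADRATIC FORM AND OF ITS SQUARE

Helper file (seat `ym-line-csu-p1`, g23).  The Dynkin formula in expectation of the tree
(`dynkin_expectation_flat_of_contDiff`, `dynkin_expectation_pair`) writes the generator of a test function `f` on a
coordinate space `ι → ℝ` as the coordinate sums `Σ_a ∂_a f(X) b_a + ½ Σ_{a,a'} ∂_{a'} ∂_a f(X) Σ_n σ_{a n} σ_{a' n}`
(`∂_a = fderiv · (Pi.single a 1)`).  For a QUADRATIC FORM `g(v) = Φ(v, v)` of a continuous bilinear map `Φ` these sums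
are evaluated in closed form (pure finite-dimensional calculus, [folklore]):

* `sum_fderiv_single_mul`, `sum_sum_fderiv_fderiv_single_mul` — coordinate sums are applications of `fderiv` /
  of the second derivative, for any `C²` function (linearity);
* ★ `quadratic_generator_terms` — for `g = Φ(·,·)`: `Σ_a ∂_a g(X) v_a = Φ v X + Φ X v` and
  `Σ_{a,a'} ∂_{a'}∂_a g(X) w_a w'_{a'} = Φ w w' + Φ w' w`;
* ★ `quadratic_sq_generator_terms` — the same two sums for `g²`: `2 g(X) (Φ v X + Φ X v)` and
  `2 (Φ w X + Φ X w)(Φ w' X + Φ X w') + 2 g(X) (Φ w w' + Φ w' w)`;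
* `contDiff_quadratic`, `contDiff_quadratic_sq`, and the LOCALISATION lemma `generator_terms_congr_of_eventuallyEq`
  (the two sums only depend on the germ of `f` at `X`, so a compactly supported cut-off `χ • g`, `χ = 1` near `X`,
  has the same sums).

Used by the conjugation identity for SZZ solutions (sibling file): the conjugated product `(ρU²_e)ᴴ ρU¹_e` is such a
quadratic form of the pair coordinates, and its carré du champ along the pair process VANISHES.  THEOREMS ONLY, no
sorry.  HONEST FRAMING: calculus plumbing; nothing about Yang–Mills is proved here; the mass gap is NOT proved.
-/

set_option autoImplicit false

noncomputable section

namespace Summit.QuantumFields.YangMills.Theorems.ColdStartUniversality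

open scoped BigOperators Topology
open Filter Finset

section Coordinates

variable {ι : Type*} [Fintype ι] [DecidableEq ι]

/-- `Σ_a L(e_a) v_a = L v` for a continuous linear functional on `ι → ℝ`. [folklore] -/
theorem sum_clm_single_mul (Lf : (ι → ℝ) →L[ℝ] ℝ) (v : ι → ℝ) :
    ∑ a, Lf (Pi.single a 1) * v a = Lf v := by
  have hv : v = ∑ a, v a • (Pi.single a (1 : ℝ) : ι → ℝ) := by
    ext a'
    simp only [Finset.sum_apply, Pi.smul_apply, Pi.single_apply, smul_eq_mul, mul_ite, mul_one, mul_zero,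
      Finset.sum_ite_eq, Finset.mem_univ, if_true]
  conv_rhs => rw [hv]
  rw [map_sum]
  refine Finset.sum_congr rfl fun a _ => ?_
  rw [map_smul, smul_eq_mul, mul_comm]

/-- **First-order coordinate sum = directional derivative**: `Σ_a ∂_a f(X) v_a = fderiv f X v`. [folklore] -/
theorem sum_fderiv_single_mul (f : (ι → ℝ) → ℝ) (X v : ι → ℝ) :
    ∑ a, fderiv ℝ f X (Pi.single a 1) * v a = fderiv ℝ f X v :=
  sum_clm_single_mul (fderiv ℝ f X) v

/-- **Second-order coordinate sum = second directional derivative** for a function differentiable near `X` with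
differentiable partial derivatives: `Σ_{a,a'} ∂_{a'} ∂_a f(X) w_a w'_{a'} = fderiv (z ↦ fderiv f z w) X w'`. [folklore] -/
theorem sum_sum_fderiv_fderiv_single_mul (f : (ι → ℝ) → ℝ) (X w w' : ι → ℝ)
    (hd : ∀ a, DifferentiableAt ℝ (fun z => fderiv ℝ f z (Pi.single a 1)) X)
    (hlin : ∀ᶠ z in 𝓝 X, DifferentiableAt ℝ f z) :
    ∑ a, ∑ a', fderiv ℝ (fun z => fderiv ℝ f z (Pi.single a 1)) X (Pi.single a' 1) * w a * w' a' =
      fderiv ℝ (fun z => fderiv ℝ f z w) X w' := by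
  -- inner sums over `a'`
  have h1 : ∀ a, ∑ a', fderiv ℝ (fun z => fderiv ℝ f z (Pi.single a 1)) X (Pi.single a' 1) * w a * w' a' =
      w a * fderiv ℝ (fun z => fderiv ℝ f z (Pi.single a 1)) X w' := by
    intro a
    have := sum_clm_single_mul (fderiv ℝ (fun z => fderiv ℝ f z (Pi.single a 1)) X) w'
    rw [← this, Finset.mul_sum]
    refine Finset.sum_congr rfl fun a' _ => by ring
  simp_rw [h1]
  -- `z ↦ fderiv f z w = Σ_a w_a fderiv f z (e_a)` near `X`
  have hw : (fun z => fderiv ℝ f z w) =ᶠ[𝓝 X] fun z => ∑ a, w a * fderiv ℝ f z (Pi.single a 1) := by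
    filter_upwards [hlin] with z _
    rw [← sum_fderiv_single_mul f z w]
    exact Finset.sum_congr rfl fun a _ => mul_comm _ _
  rw [hw.fderiv_eq]
  have hds : ∀ a ∈ (Finset.univ : Finset ι),
      DifferentiableAt ℝ (fun z => w a * fderiv ℝ f z (Pi.single a 1)) X := fun a _ => (hd a).const_mul _
  rw [fderiv_fun_sum hds, _root_.sum_apply]
  refine Finset.sum_congr rfl fun a _ => ?_
  rw [fderiv_const_mul (hd a), _root_.smul_apply, smul_eq_mul]

/-- **Localisation**: the two coordinate sums of the generator depend only on the germ of the test function at `X`.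
[folklore] -/
theorem generator_terms_congr_of_eventuallyEq {f g : (ι → ℝ) → ℝ} {X : ι → ℝ} (h : f =ᶠ[𝓝 X] g) :
    (∀ v : ι → ℝ, ∑ a, fderiv ℝ f X (Pi.single a 1) * v a = ∑ a, fderiv ℝ g X (Pi.single a 1) * v a) ∧
    ∀ w w' : ι → ℝ, ∑ a, ∑ a', fderiv ℝ (fun z => fderiv ℝ f z (Pi.single a 1)) X (Pi.single a' 1) * w a * w' a' =
      ∑ a, ∑ a', fderiv ℝ (fun z => fderiv ℝ g z (Pi.single a 1)) X (Pi.single a' 1) * w a * w' a' := by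
  refine ⟨fun v => by rw [h.fderiv_eq], fun w w' => ?_⟩
  have h2 : ∀ a, (fun z => fderiv ℝ f z (Pi.single a 1)) =ᶠ[𝓝 X] fun z => fderiv ℝ g z (Pi.single a 1) := by
    intro a
    have h' : ∀ᶠ z in 𝓝 X, f =ᶠ[𝓝 z] g := h.eventually_nhds
    filter_upwards [h'] with z hz
    rw [hz.fderiv_eq]
  refine Finset.sum_congr rfl fun a _ => Finset.sum_congr rfl fun a' _ => ?_
  rw [(h2 a).fderiv_eq]

end Coordinates

/-! ## Quadratic forms -/

section Quadratic

variable {ι : Type*} [Fintype ι] (Φ : (ι → ℝ) →L[ℝ] (ι → ℝ) →L[ℝ] ℝ)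

/-- The derivative of the quadratic form `v ↦ Φ v v` at `X` is `h ↦ Φ X h + Φ h X`. [folklore] -/
theorem hasFDerivAt_quadratic (X : ι → ℝ) :
    HasFDerivAt (fun v => Φ v v) (Φ X + Φ.flip X) X := by
  have h := Φ.hasFDerivAt_of_bilinear (hasFDerivAt_id X) (hasFDerivAt_id X)
  refine h.congr_fderiv ?_
  ext h'
  simp [ContinuousLinearMap.precompR_apply, ContinuousLinearMap.precompL_apply]

/-- `fderiv` of the quadratic form, applied. [folklore] -/
theorem fderiv_quadratic_apply (X h : ι → ℝ) : fderiv ℝ (fun v => Φ v v) X h = Φ X h + Φ h X := by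
  rw [(hasFDerivAt_quadratic Φ X).fderiv]
  simp

/-- The quadratic form is smooth. [folklore] -/
theorem contDiff_quadratic {n : WithTop ℕ∞} : ContDiff ℝ n (fun v : ι → ℝ => Φ v v) :=
  Φ.isBoundedBilinearMap.contDiff.comp (contDiff_id.prodMk contDiff_id)

/-- The square of the quadratic form is smooth. [folklore] -/
theorem contDiff_quadratic_sq {n : WithTop ℕ∞} : ContDiff ℝ n (fun v : ι → ℝ => Φ v v * Φ v v) :=
  (contDiff_quadratic Φ).mul (contDiff_quadratic Φ)

/-- The partial derivative `z ↦ ∂_u (Φ z z) = Φ z u + Φ u z` is a continuous affine-linear map of `z`, with derivative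
`w ↦ Φ w u + Φ u w`. [folklore] -/
theorem hasFDerivAt_fderiv_quadratic (X u : ι → ℝ) :
    HasFDerivAt (fun z => fderiv ℝ (fun v => Φ v v) z u) (Φ.flip u + Φ u) X := by
  have hfun : (fun z => fderiv ℝ (fun v => Φ v v) z u) = fun z => (Φ.flip u + Φ u) z := by
    funext z
    rw [fderiv_quadratic_apply]
    simp
  rw [hfun]
  exact (Φ.flip u + Φ u).hasFDerivAt

/-- ★ **Generator terms of a quadratic form**: `Σ_a ∂_a g(X) v_a = Φ v X + Φ X v` and
`Σ_{a,a'} ∂_{a'} ∂_a g(X) w_a w'_{a'} = Φ w w' + Φ w' w` for `g = Φ(·,·)`. [folklore] -/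
theorem quadratic_generator_terms [DecidableEq ι] (X v w w' : ι → ℝ) :
    (∑ a, fderiv ℝ (fun z => Φ z z) X (Pi.single a 1) * v a = Φ v X + Φ X v) ∧
    (∑ a, ∑ a', fderiv ℝ (fun z => fderiv ℝ (fun y => Φ y y) z (Pi.single a 1)) X (Pi.single a' 1) * w a * w' a' =
      Φ w w' + Φ w' w) := by
  refine ⟨?_, ?_⟩
  · rw [sum_fderiv_single_mul, fderiv_quadratic_apply, add_comm]
  · rw [sum_sum_fderiv_fderiv_single_mul (fun z => Φ z z) X w w'
      (fun a => (hasFDerivAt_fderiv_quadratic Φ X _).differentiableAt)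
      (Filter.Eventually.of_forall fun z => (hasFDerivAt_quadratic Φ z).differentiableAt),
      (hasFDerivAt_fderiv_quadratic Φ X w).fderiv]
    simp [add_comm]

/-- ★ **Generator terms of the SQUARE of a quadratic form** `h = g²`, `g = Φ(·,·)`:
`Σ_a ∂_a h(X) v_a = 2 g(X) (Φ v X + Φ X v)` and
`Σ_{a,a'} ∂_{a'} ∂_a h(X) w_a w'_{a'} = 2 (Φ w X + Φ X w)(Φ w' X + Φ X w') + 2 g(X) (Φ w w' + Φ w' w)`. [folklore] -/
theorem quadratic_sq_generator_terms [DecidableEq ι] (X v w w' : ι → ℝ) :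
    (∑ a, fderiv ℝ (fun z => Φ z z * Φ z z) X (Pi.single a 1) * v a = 2 * Φ X X * (Φ v X + Φ X v)) ∧
    (∑ a, ∑ a', fderiv ℝ (fun z => fderiv ℝ (fun y => Φ y y * Φ y y) z (Pi.single a 1)) X (Pi.single a' 1) *
        w a * w' a' =
      2 * (Φ w X + Φ X w) * (Φ w' X + Φ X w') + 2 * Φ X X * (Φ w w' + Φ w' w)) := by
  -- first derivative of the square
  have hsq : ∀ z u : ι → ℝ, fderiv ℝ (fun y => Φ y y * Φ y y) z u = 2 * Φ z z * (Φ z u + Φ u z) := by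
    intro z u
    have h : HasFDerivAt (fun y => Φ y y * Φ y y) (Φ z z • (Φ z + Φ.flip z) + Φ z z • (Φ z + Φ.flip z)) z :=
      (hasFDerivAt_quadratic Φ z).mul (hasFDerivAt_quadratic Φ z)
    rw [h.fderiv]
    simp only [_root_.add_apply, _root_.smul_apply, ContinuousLinearMap.flip_apply, smul_eq_mul]
    ring
  refine ⟨?_, ?_⟩
  · rw [sum_fderiv_single_mul, hsq, add_comm (Φ X v)]
  · -- the partial derivatives of the square are differentiable, with an explicit derivative
    have hd : ∀ u : ι → ℝ, HasFDerivAt (fun z => fderiv ℝ (fun y => Φ y y * Φ y y) z u)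
        ((2 * (Φ X u + Φ u X)) • (Φ X + Φ.flip X) + (2 * Φ X X) • (Φ.flip u + Φ u)) X := by
      intro u
      have hfun : (fun z => fderiv ℝ (fun y => Φ y y * Φ y y) z u) =
          fun z => (2 * Φ z z) * fderiv ℝ (fun v => Φ v v) z u := by
        funext z; rw [hsq, fderiv_quadratic_apply]
      rw [hfun]
      have h1 : HasFDerivAt (fun z => 2 * Φ z z) ((2 : ℝ) • (Φ X + Φ.flip X)) X :=
        (hasFDerivAt_quadratic Φ X).const_mul 2
      have h2 := hasFDerivAt_fderiv_quadratic Φ X u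
      have h := h1.mul h2
      refine h.congr_fderiv ?_
      rw [fderiv_quadratic_apply]
      ext y
      simp only [_root_.add_apply, _root_.smul_apply, ContinuousLinearMap.flip_apply, smul_eq_mul]
      ring
    rw [sum_sum_fderiv_fderiv_single_mul (fun z => Φ z z * Φ z z) X w w' (fun a => (hd _).differentiableAt)
      (Filter.Eventually.of_forall fun z => (contDiff_quadratic_sq Φ (n := 1)).differentiable one_ne_zero z),
      (hd w).fderiv]
    simp only [_root_.add_apply, _root_.smul_apply, ContinuousLinearMap.flip_apply, smul_eq_mul]
    ring

/-- **A bilinear form on the finite-dimensional coordinate space is a continuous bilinear map** (so that the lemmas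
above apply to any algebraically bilinear `φ`). [folklore] -/
theorem exists_clm_bilinear (φ : (ι → ℝ) →ₗ[ℝ] (ι → ℝ) →ₗ[ℝ] ℝ) :
    ∃ Ψ : (ι → ℝ) →L[ℝ] (ι → ℝ) →L[ℝ] ℝ, ∀ u w, Ψ u w = φ u w := by
  let ψ : (ι → ℝ) →ₗ[ℝ] ((ι → ℝ) →L[ℝ] ℝ) :=
    (LinearMap.toContinuousLinearMap : ((ι → ℝ) →ₗ[ℝ] ℝ) ≃ₗ[ℝ] ((ι → ℝ) →L[ℝ] ℝ)).toLinearMap ∘ₗ φ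
  refine ⟨LinearMap.toContinuousLinearMap ψ, fun u w => ?_⟩
  simp [ψ]

end Quadratic

/-! ## Cut-off: compactly supported test functions agreeing with `g` near a bounded range -/

section Cutoff

variable {ι : Type*} [Fintype ι]

/-- **Smooth compactly supported cut-off of a smooth function**: for every `R` there is `χg`, `C^∞` with compact
support, agreeing with `g` on a neighbourhood of every point of the closed ball of radius `R` (so all derivatives
agree there). [folklore] -/
theorem exists_contDiff_hasCompactSupport_eqOn {g : (ι → ℝ) → ℝ} {n : ℕ∞} (hg : ContDiff ℝ n g) (R : ℝ) :
    ∃ f : (ι → ℝ) → ℝ, ContDiff ℝ n f ∧ HasCompactSupport f ∧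
      ∀ X : ι → ℝ, ‖X‖ ≤ R → f =ᶠ[𝓝 X] g := by
  classical
  let χ : ContDiffBump (0 : ι → ℝ) := ⟨|R| + 1, |R| + 2, by positivity, by linarith⟩
  refine ⟨fun v => χ v * g v, χ.contDiff.mul hg, χ.hasCompactSupport.mul_right, fun X hX => ?_⟩
  have hXin : X ∈ Metric.ball (0 : ι → ℝ) χ.rIn := by
    rw [Metric.mem_ball, dist_zero_right]
    exact lt_of_le_of_lt (hX.trans (le_abs_self R)) (by simp [χ])
  filter_upwards [χ.eventuallyEq_one_of_mem_ball hXin] with v hv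
  simp [hv]

end Cutoff

end Summit.QuantumFields.YangMills.Theorems.ColdStartUniversality

end
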